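import Literature.NumberTheory.EllipticCurves.KubertTateFiveMuDescentNumberFieldValuation
import Literature.NumberTheory.EllipticCurves.KubertTateFiveSelmerTameSqrtNegTwo
import HarnessLib

/-!
# The `5`-descent on the Kubert–Tate family `E_{m,n}` over `ℚ(√−2)`: the box —
# `#Sel^ψ(E'/K) ≤ 5^{#S}`, `#Sel^ψ = #(E(K)/5E(K)) · #ker Ш(ψ)`, `rank E_{m,n}(K) + 1 ≤ #S`,
# and `Ш(E_{m,n}/K)[5^∞] = 0` when the `K`-points fill the box (`K = ℚ(√−2)`, tame régime)

PROOF-ONLY file (theorems only, no definition, no named fact, no `sorry`), topic `NumberTheory/EllipticCurves`;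
the `ℚ(√−2)` twin of the tree's `KubertTateFiveMuDescentGaussianBox` (`ℚ(i)`) and `KubertTateFiveMuDescentEisensteinBox`
(`ℚ(ζ₃)`).  Setting: a number field `K` with `[K : ℚ] = 2` and `θ ∈ K`, `θ² = −2` (tree `SqrtNegTwo.FieldData θ`),
`E = E_{m,n} = [n-m, -mn, -mn², 0, 0]` base-changed to `K`, Vélu's `5`-isogeny `φ : E → E' = E/⟨T⟩` and its dual `ψ`,
a `K`-rational point `P₁` with `25 P₁ ≠ O`, and a finite set `S` of finite places of `K` off which `m, n` are units.

* §1 (private) `natCard_selmerGroup_dual_le_of_support_sqrtNegTwo` — **`#Sel^ψ(E'_{m,n}/K) ≤ 5 ^ #S`**: the injective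
  Kummer invariant followed by the exponents `(v(a) mod 5)_{v ∈ S}` is injective on `Sel^ψ`, the kernel being
  `ℚ(√−2)(∅, 5) = 1` (tree `exists_eq_pow_of_forall_dvd_log_valuation_sqrtNegTwo`: `ℤ[√−2]` principal, units `±1`).
* §2 the `ℚ(√−2)` TAME RÉGIME (`5 ∤ Δ`; bad `ℓ ≢ 1 (mod 5)`; `ℓ ≡ 4 (mod 5) ⇒ ℓ ∥ x² + 2` for some `x`, i.e. `ℓ` split):
  `range_pointHom_dual_eq_sqrtNegTwo` (`ψ(E'(K)) = 5E(K)`, from `Sel^φ = 0`, tree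
  `KubertTateVelu.selmerGroup_fiveIsogeny_eq_bot_sqrtNegTwo`), `natCard_selmerGroup_dual_eq_sqrtNegTwo`
  (`#Sel^ψ = #(E(K)/5E(K)) · #ker Ш(ψ)`), `natCard_quotient_le_sqrtNegTwo`, **`mordellWeilRank_succ_le_sqrtNegTwo`**
  (`rank E_{m,n}(K) + 1 ≤ #S`); and when the `K`-points FILL the box (`5 ^ #S ≤ #(E(K)/5E(K))`):
  **`sha_torsionBy_five_eq_bot_of_le_sqrtNegTwo`** (`Ш(E/K)[5] = 0`), **`shaCorank_five_eq_zero_of_le_sqrtNegTwo`**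
  (`t₅(E_{m,n}/K) = 0`), `primaryComponent_sha_five_eq_bot_of_le_sqrtNegTwo`, `natCard_quotient_eq_of_le_sqrtNegTwo`.

Why (stmt-BirchSwinnertonDyer-22356, «T = FiniteShaComponentTransfer»; BSD and T are NOT proved by this): with
`Sel₅(E/K) = Sel₅(E/ℚ) ⊕ Sel₅(E^{(−8)}/ℚ)` (`d_K = −8`) the box over `K` opens the door at `5` on the quadratic twists
`E_{m,n}^{(−8)}` — curves without rational `5`-torsion at which `5` (inert in `ℚ(√−2)`) is a NON-anomalous good
ordinary prime (`a₅(E^{(−8)}) = −a₅(E) ≡ −1 (mod 5)`): the third quadratic field of the instrument, after `ℚ(i)`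
(anomalous twists) and `ℚ(ζ₃)`.

## References

* [SilvermanAEC2009] J. H. Silverman, *AEC*, 2nd ed., Thm. X.4.2, Prop. X.4.9, Prop. VIII.1.6, Exercise 10.1(c).
* [Fisher2001FiveSevenDescent] T. Fisher, JEMS 3 (2001), §§1–2.
* [Mazur1977] B. Mazur, *Modular curves and the Eisenstein ideal*, Ch. III §3 Thm. (3.1).
-/

noncomputable section

open scoped Classical NNReal NumberField AddSubgroup
open WeierstrassCurve WeierstrassCurve.Isogeny Field IsDedekindDomain
open Literature.NumberTheory.EllipticCurves Literature.NumberTheory.EllipticCurves.KubertTateKummer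
  Literature.NumberTheory.EllipticCurves.KubertTateVelu Literature.NumberTheory.GaloisRepresentations
  Literature.NumberTheory.NumberFields Literature.NumberTheory.QuadraticFields

namespace Literature.NumberTheory.EllipticCurves

namespace KubertTateMuDescentNF

variable {K : Type} [Field K] [NumberField K]
variable (m n : ℤ) [hE : (kubertTateFive (m : K) (n : K)).IsElliptic]
variable (ψ : Isogeny (kubertTateFive' (m : K) (n : K)) (kubertTateFive (m : K) (n : K)))
  (hψ : ∀ P, ψ (fiveIsogeny (m : K) (n : K) P) = ((5 : ℕ) : ℤ) • P)
variable (P₁ : geomPoints (kubertTateFive (m : K) (n : K)))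
  (hP₁ : ∀ σ : absoluteGaloisGroup K, σ • P₁ = P₁) (h25 : ((25 : ℕ) : ℤ) • P₁ ≠ 0)
variable {θ : K} (hK : SqrtNegTwo.FieldData θ)

/-! ## §1 Over `ℚ(√−2)`: `#Sel^ψ(E'/K) ≤ 5 ^ #S` for every finite set `S` of places supporting `mn` -/

include hψ hP₁ h25 hK in
/-- (Private: prints like its `ℚ(i)` twin.) **`#Sel^ψ(E'_{m,n}/K) ≤ 5 ^ #S`** (`K = ℚ(√−2)`) for every finite set `S` of finite places of `K` off which `m` and `n`
are units (e.g. the set of Gaussian primes dividing `mn`).  The injective Kummer invariant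
(`kummerInvariant_injective`) followed by `a ↦ (v(a) mod 5)_{v ∈ S}` is injective on the Selmer group: two Selmer
classes with the same exponents on `S` differ by a class `a ∈ Kˣ` with `5 ∣ v(a)` at EVERY finite place,
i.e. a fifth power (`ℚ(√−2)(∅, 5) = 1`: `ℤ[√−2]` principal, units `±1`; tree
`exists_eq_pow_of_forall_dvd_log_valuation_sqrtNegTwo`). [cite: SilvermanAEC2009, Prop. X.4.9, Prop. VIII.1.6 and
Exercise 10.1(c)] [cite: Fisher2001FiveSevenDescent, §2] -/
private theorem natCard_selmerGroup_dual_le_of_support_sqrtNegTwo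
    (S : Finset (HeightOneSpectrum (𝓞 K)))
    (hS : ∀ v : HeightOneSpectrum (𝓞 K), v ∉ S → ((m : ℤ) : 𝓞 K) ∉ v.asIdeal ∧ ((n : ℤ) : 𝓞 K) ∉ v.asIdeal) :
    Nat.card ψ.selmerGroup ≤ 5 ^ S.card := by
  letI := ψ.kerAction
  set Κ := kummerInvariant (fiveIsogeny (m : K) (n : K)) ψ hψ (Tbar (m : K) (n : K)) (five_zsmul_Tbar (m : K) (n : K))
    (smul_Tbar (m : K) (n : K)) (ker_fiveIsogeny_eq_zmultiples (m : K) (n : K)) with hΚ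
  have hΚinj : Function.Injective Κ := kummerInvariant_injective _ _ _ _ _ (Tbar_ne_zero (m : K) (n : K)) _ _
  -- a representative in `Kˣ` of the invariant of each class
  have hrep : ∀ ξ : ψ.galH1Ker, ∃ a : Kˣ, Κ ξ = Additive.ofMul (QuotientGroup.mk a) := fun ξ ↦ by
    obtain ⟨a, ha⟩ := QuotientGroup.mk_surjective (Additive.toMul (Κ ξ))
    exact ⟨a, by rw [ha]; rfl⟩
  choose rep hrep using hrep
  let g : ψ.selmerGroup → (S → ZMod 5) := fun ξ v ↦
    (((WithZero.log (v.1.valuation K (rep ξ : K)) : ℤ) : ZMod 5))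
  have hg : Function.Injective g := by
    intro ξ ξ' hgg
    -- the quotient `a/a'` represents `Κ (ξ - ξ')`
    have hdiff : Κ ((ξ : ψ.galH1Ker) - ξ') = Additive.ofMul (QuotientGroup.mk (rep ξ / rep ξ')) := by
      rw [map_sub, hrep, hrep, QuotientGroup.mk_div, ofMul_div]
    have hmem : ((ξ : ψ.galH1Ker) - ξ') ∈ ψ.selmerGroup := ψ.selmerGroup.sub_mem ξ.2 ξ'.2
    have hall : ∀ v : HeightOneSpectrum (𝓞 K),
        (5 : ℤ) ∣ WithZero.log (v.valuation K ((rep ξ / rep ξ' : Kˣ) : K)) := by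
      intro v
      have hdiv : ((rep ξ / rep ξ' : Kˣ) : K) = (rep ξ : K) / (rep ξ' : K) := Units.val_div_eq_div_val _ _
      by_cases hvS : v ∈ S
      · have hv' := congrFun hgg ⟨v, hvS⟩
        simp only [g] at hv'
        have hva : v.valuation K (rep ξ : K) ≠ 0 := (Valuation.ne_zero_iff _).mpr (rep ξ).ne_zero
        have hva' : v.valuation K (rep ξ' : K) ≠ 0 := (Valuation.ne_zero_iff _).mpr (rep ξ').ne_zero
        rw [hdiv, map_div₀, WithZero.log_div hva hva']
        exact (ZMod.intCast_eq_intCast_iff_dvd_sub _ _ 5).mp hv'.symm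
      · obtain ⟨hvm, hvn⟩ := hS v hvS
        exact five_dvd_log_valuation_of_mem_selmerGroup m n ψ hψ P₁ hP₁ h25 v hmem hdiff hvm hvn
    obtain ⟨w, hw⟩ := exists_eq_pow_of_forall_dvd_log_valuation_sqrtNegTwo hK (n := 5) (by decide)
      (rep ξ / rep ξ').ne_zero hall
    have hw0 : w ≠ 0 := by
      intro h0
      rw [h0, zero_pow (by norm_num)] at hw
      exact (rep ξ / rep ξ').ne_zero hw
    have h1 : (QuotientGroup.mk (rep ξ / rep ξ') : Kˣ ⧸ (powMonoidHom 5 : Kˣ →* Kˣ).range) = 1 := by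
      rw [QuotientGroup.eq_one_iff]
      exact ⟨Units.mk0 w hw0, Units.ext (by rw [powMonoidHom_apply, Units.val_pow_eq_pow_val, Units.val_mk0, ← hw])⟩
    rw [h1, ofMul_one] at hdiff
    have h0 : (ξ : ψ.galH1Ker) - ξ' = 0 := hΚinj (by rw [hdiff, map_zero])
    exact Subtype.ext (sub_eq_zero.mp h0)
  have hcard := Nat.card_le_card_of_injective g hg
  have hfun : Nat.card (S → ZMod 5) = 5 ^ S.card := by
    rw [Nat.card_fun, Nat.card_eq_fintype_card (α := ZMod 5), ZMod.card, Nat.card_eq_fintype_card,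
      Fintype.card_coe]
  rw [hfun] at hcard
  exact hcard


/-! ## §2 The `ℚ(√−2)` tame régime: `#Sel^ψ = #(E(K)/5E(K)) · #ker Ш(ψ)`, `rank ≤ #S − 1`, and `Ш[5] = 0` when the box is full -/

section Tame


include hψ hK in
/-- **`ψ(E'(K)) = 5E(K)` in the tame régime**: `E'(K) = φ(E(K))` (`Sel^φ = 0`, tree
`KubertTateVelu.selmerGroup_fiveIsogeny_eq_bot_sqrtNegTwo`) and `ψ ∘ φ = [5]`. [cite: SilvermanAEC2009, Thm. X.4.2(a)]
[cite: Mazur1977, Ch. III §3 Thm. (3.1)] -/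
theorem range_pointHom_dual_eq_sqrtNegTwo
    (h5 : ¬ (5 : ℤ) ∣ (kubertTateFive m n).Δ)
    (hbad : ∀ ℓ : ℕ, ℓ.Prime → (ℓ : ℤ) ∣ (kubertTateFive m n).Δ → ℓ % 5 ≠ 1 ∧
      (ℓ % 5 = 4 → ∃ x : ℤ, (ℓ : ℤ) ∣ x ^ 2 + 2 ∧ ¬ (ℓ : ℤ) ^ 2 ∣ x ^ 2 + 2))
    (g : (kubertTateFive' (m : K) (n : K)).toAffine.Point →+ (kubertTateFive (m : K) (n : K)).toAffine.Point)
    (hg : ∀ P', toGeomPoints _ (g P') = ψ (toGeomPoints _ P')) :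
    g.range = (nsmulAddMonoidHom (5 : ℕ) :
      (kubertTateFive (m : K) (n : K)).toAffine.Point →+ (kubertTateFive (m : K) (n : K)).toAffine.Point).range := by
  obtain ⟨f, hf⟩ := (fiveIsogeny (m : K) (n : K)).exists_pointHom
  have hgf : ∀ P : (kubertTateFive (m : K) (n : K)).toAffine.Point, g (f P) = (5 : ℕ) • P := fun P ↦ by
    apply toGeomPoints_injective (kubertTateFive (m : K) (n : K))
    rw [hg, hf, hψ, map_nsmul, natCast_zsmul]
  ext Q
  constructor
  · rintro ⟨P', rfl⟩
    obtain ⟨P, hP⟩ := ConstantKernelDescent.exists_toGeomPoints_eq_of_selmerGroup_eq_bot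
      (fiveIsogeny (m : K) (n : K)) (KubertTateVelu.selmerGroup_fiveIsogeny_eq_bot_sqrtNegTwo m n hK h5 hbad) P'
    have hP' : P' = f P := toGeomPoints_injective (kubertTateFive' (m : K) (n : K)) (by rw [hP, hf])
    exact ⟨P, by rw [nsmulAddMonoidHom_apply, hP', hgf]⟩
  · rintro ⟨P, rfl⟩
    exact ⟨f P, by rw [nsmulAddMonoidHom_apply, hgf]⟩

include hψ hK in
/-- **`#Sel^ψ(E'/K) = #(E(K)/5E(K)) · #ker Ш(ψ)` in the tame régime** (Silverman X.4.2(a) counted, tree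
`Isogeny.natCard_selmerGroup_eq`, with `ψ(E'(K)) = 5E(K)`). [cite: SilvermanAEC2009, Thm. X.4.2(a)] -/
theorem natCard_selmerGroup_dual_eq_sqrtNegTwo
    (h5 : ¬ (5 : ℤ) ∣ (kubertTateFive m n).Δ)
    (hbad : ∀ ℓ : ℕ, ℓ.Prime → (ℓ : ℤ) ∣ (kubertTateFive m n).Δ → ℓ % 5 ≠ 1 ∧
      (ℓ % 5 = 4 → ∃ x : ℤ, (ℓ : ℤ) ∣ x ^ 2 + 2 ∧ ¬ (ℓ : ℤ) ^ 2 ∣ x ^ 2 + 2)) :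
    Nat.card ψ.selmerGroup =
      Nat.card ((kubertTateFive (m : K) (n : K)).toAffine.Point ⧸ (nsmulAddMonoidHom (5 : ℕ) :
        (kubertTateFive (m : K) (n : K)).toAffine.Point →+ (kubertTateFive (m : K) (n : K)).toAffine.Point).range) *
      Nat.card (shaMap ψ.toAddMonoidHom ψ.equivariant ψ.hasLocalPointsMaps_toAddMonoidHom).ker := by
  obtain ⟨g, hg⟩ := ψ.exists_pointHom
  rw [ψ.natCard_selmerGroup_eq g hg, range_pointHom_dual_eq_sqrtNegTwo m n ψ hψ hK h5 hbad g hg, AddSubgroup.index_eq_card]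

include hψ in
/-- `ker Ш(ψ)` is finite (it embeds in `Ш(E'/K)[5]`, finite by weak Mordell–Weil; tree `finite_ker_shaMap`).
[cite: SilvermanAEC2009, Thm. X.4.2(b)] -/
private theorem finite_ker_shaMap_dual_sqrtNegTwo :
    Finite (shaMap ψ.toAddMonoidHom ψ.equivariant ψ.hasLocalPointsMaps_toAddMonoidHom).ker :=
  (finite_ker_shaMap ψ.toAddMonoidHom ψ.equivariant ψ.hasLocalPointsMaps_toAddMonoidHom
    (fiveIsogeny (m : K) (n : K)).toAddMonoidHom (fiveIsogeny (m : K) (n : K)).equivariant (n := 5) (by norm_num)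
    (fun Q ↦ by rw [Isogeny.coe_toAddMonoidHom, Isogeny.coe_toAddMonoidHom, comp_dual_eq m n ψ hψ Q])).to_subtype

include hψ hP₁ h25 hK in
/-- **`#(E(K)/5E(K)) ≤ 5 ^ #S` in the tame régime** (from `#Sel^ψ ≤ 5 ^ #S` and `#ker Ш(ψ) ≥ 1`).
[cite: SilvermanAEC2009, Thm. X.4.2 and Prop. X.4.9] [cite: Fisher2001FiveSevenDescent, §2] -/
theorem natCard_quotient_le_sqrtNegTwo
    (S : Finset (HeightOneSpectrum (𝓞 K)))
    (hS : ∀ v : HeightOneSpectrum (𝓞 K), v ∉ S → ((m : ℤ) : 𝓞 K) ∉ v.asIdeal ∧ ((n : ℤ) : 𝓞 K) ∉ v.asIdeal)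
    (h5 : ¬ (5 : ℤ) ∣ (kubertTateFive m n).Δ)
    (hbad : ∀ ℓ : ℕ, ℓ.Prime → (ℓ : ℤ) ∣ (kubertTateFive m n).Δ → ℓ % 5 ≠ 1 ∧
      (ℓ % 5 = 4 → ∃ x : ℤ, (ℓ : ℤ) ∣ x ^ 2 + 2 ∧ ¬ (ℓ : ℤ) ^ 2 ∣ x ^ 2 + 2)) :
    Nat.card ((kubertTateFive (m : K) (n : K)).toAffine.Point ⧸ (nsmulAddMonoidHom (5 : ℕ) :
        (kubertTateFive (m : K) (n : K)).toAffine.Point →+ (kubertTateFive (m : K) (n : K)).toAffine.Point).range) ≤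
      5 ^ S.card := by
  haveI := finite_ker_shaMap_dual_sqrtNegTwo m n ψ hψ
  have h := natCard_selmerGroup_dual_le_of_support_sqrtNegTwo m n ψ hψ P₁ hP₁ h25 hK S hS
  rw [natCard_selmerGroup_dual_eq_sqrtNegTwo m n ψ hψ hK h5 hbad] at h
  have hpos : 0 < Nat.card (shaMap ψ.toAddMonoidHom ψ.equivariant ψ.hasLocalPointsMaps_toAddMonoidHom).ker :=
    Nat.card_pos
  nlinarith

include hψ hP₁ h25 hK in
/-- **`5 ^ (rank E_{m,n}(K) + 1) ≤ 5 ^ #S`, i.e. `rank E_{m,n}(K) ≤ #S − 1`, in the tame régime**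
(`#(E(K)/5E(K)) = 5^rank · #E(K)[5]`, tree `natCard_quotient_nsmulRange_eq`, and `T ∈ E(K)[5]` has order `5`).
[cite: SilvermanAEC2009, Thm. X.4.2 and Prop. X.4.9] [cite: Fisher2001FiveSevenDescent, §2] -/
theorem pow_mordellWeilRank_succ_le_sqrtNegTwo
    (S : Finset (HeightOneSpectrum (𝓞 K)))
    (hS : ∀ v : HeightOneSpectrum (𝓞 K), v ∉ S → ((m : ℤ) : 𝓞 K) ∉ v.asIdeal ∧ ((n : ℤ) : 𝓞 K) ∉ v.asIdeal)
    (h5 : ¬ (5 : ℤ) ∣ (kubertTateFive m n).Δ)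
    (hbad : ∀ ℓ : ℕ, ℓ.Prime → (ℓ : ℤ) ∣ (kubertTateFive m n).Δ → ℓ % 5 ≠ 1 ∧
      (ℓ % 5 = 4 → ∃ x : ℤ, (ℓ : ℤ) ∣ x ^ 2 + 2 ∧ ¬ (ℓ : ℤ) ^ 2 ∣ x ^ 2 + 2)) :
    5 ^ ((kubertTateFive (m : K) (n : K)).mordellWeilRank + 1) ≤ 5 ^ S.card := by
  haveI : Module.Finite ℤ (kubertTateFive (m : K) (n : K)).toAffine.Point := by
    convert module_finite_point_holds (kubertTateFive (m : K) (n : K))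
  have hcard := natCard_quotient_nsmulRange_eq (kubertTateFive (m : K) (n : K)).toAffine.Point 5
  have hle := natCard_quotient_le_sqrtNegTwo m n ψ hψ P₁ hP₁ h25 hK S hS h5 hbad
  rw [hcard] at hle
  -- `#E(K)[5] ≥ 5`: the rational point `(0,0)` has order `5`
  obtain ⟨hm0, hn0, -⟩ := ne_zero_of_isElliptic (m : K) (n : K)
  obtain ⟨T, hT⟩ := exists_addOrderOf_eq_five_kubertTateFive hm0 hn0
  have h5T : 5 ≤ Nat.card (AddSubgroup.torsionBy (kubertTateFive (m : K) (n : K)).toAffine.Point ((5 : ℕ) : ℤ)) := by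
    -- `E(K)[5] ↪ E(K̄)[5]`, finite
    haveI : Finite (AddSubgroup.torsionBy (kubertTateFive (m : K) (n : K)).toAffine.Point ((5 : ℕ) : ℤ)) :=
      Literature.NumberTheory.EllipticCurves.finite_torsionBy_of_injective
        (toGeomPoints (kubertTateFive (m : K) (n : K))) (toGeomPoints_injective _) _
        (WeierstrassCurve.finite_torsionBy_of_isAlgClosed
          (V := (kubertTateFive (m : K) (n : K)).baseChange (AlgebraicClosure K)) (by norm_num))
    have hsub : AddSubgroup.zmultiples T ≤ AddSubgroup.torsionBy _ ((5 : ℕ) : ℤ) := by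
      rw [AddSubgroup.zmultiples_le, mem_torsionBy_iff, natCast_zsmul, ← hT, addOrderOf_nsmul_eq_zero]
    have := AddSubgroup.card_le_of_le hsub
    rwa [Nat.card_zmultiples, hT] at this
  have hr : (kubertTateFive (m : K) (n : K)).mordellWeilRank =
      Module.finrank ℤ (kubertTateFive (m : K) (n : K)).toAffine.Point := by
    unfold WeierstrassCurve.mordellWeilRank; congr!
  rw [hr, pow_succ]
  calc 5 ^ Module.finrank ℤ (kubertTateFive (m : K) (n : K)).toAffine.Point * 5
      ≤ 5 ^ Module.finrank ℤ (kubertTateFive (m : K) (n : K)).toAffine.Point *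
          Nat.card (AddSubgroup.torsionBy (kubertTateFive (m : K) (n : K)).toAffine.Point ((5 : ℕ) : ℤ)) :=
        Nat.mul_le_mul_left _ h5T
    _ ≤ 5 ^ S.card := hle

include hψ hP₁ h25 hK in
/-- **`rank E_{m,n}(K) + 1 ≤ #S` in the tame régime** (with a rational point of infinite order present).
[cite: SilvermanAEC2009, Thm. X.4.2 and Prop. X.4.9] [cite: Fisher2001FiveSevenDescent, §2] -/
theorem mordellWeilRank_succ_le_sqrtNegTwo
    (S : Finset (HeightOneSpectrum (𝓞 K)))
    (hS : ∀ v : HeightOneSpectrum (𝓞 K), v ∉ S → ((m : ℤ) : 𝓞 K) ∉ v.asIdeal ∧ ((n : ℤ) : 𝓞 K) ∉ v.asIdeal)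
    (h5 : ¬ (5 : ℤ) ∣ (kubertTateFive m n).Δ)
    (hbad : ∀ ℓ : ℕ, ℓ.Prime → (ℓ : ℤ) ∣ (kubertTateFive m n).Δ → ℓ % 5 ≠ 1 ∧
      (ℓ % 5 = 4 → ∃ x : ℤ, (ℓ : ℤ) ∣ x ^ 2 + 2 ∧ ¬ (ℓ : ℤ) ^ 2 ∣ x ^ 2 + 2)) :
    (kubertTateFive (m : K) (n : K)).mordellWeilRank + 1 ≤ S.card :=
  (Nat.pow_le_pow_iff_right (by norm_num)).mp (pow_mordellWeilRank_succ_le_sqrtNegTwo m n ψ hψ P₁ hP₁ h25 hK S hS h5 hbad)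

include hψ hP₁ h25 hK in
/-- **`Ш(E'/K)[ψ] = 0` when the rational points fill the box**: if `#(E(K)/5E(K)) ≥ 5 ^ #S` then
`#(E(K)/5E(K)) · #ker Ш(ψ) = #Sel^ψ ≤ 5 ^ #S` forces `ker Ш(ψ) = ⊥`. [cite: SilvermanAEC2009, Thm. X.4.2(a) and Prop. X.4.9]
[cite: Fisher2001FiveSevenDescent, §2] -/
private theorem ker_shaMap_dual_eq_bot_of_le_sqrtNegTwo
    (S : Finset (HeightOneSpectrum (𝓞 K)))
    (hS : ∀ v : HeightOneSpectrum (𝓞 K), v ∉ S → ((m : ℤ) : 𝓞 K) ∉ v.asIdeal ∧ ((n : ℤ) : 𝓞 K) ∉ v.asIdeal)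
    (h5 : ¬ (5 : ℤ) ∣ (kubertTateFive m n).Δ)
    (hbad : ∀ ℓ : ℕ, ℓ.Prime → (ℓ : ℤ) ∣ (kubertTateFive m n).Δ → ℓ % 5 ≠ 1 ∧
      (ℓ % 5 = 4 → ∃ x : ℤ, (ℓ : ℤ) ∣ x ^ 2 + 2 ∧ ¬ (ℓ : ℤ) ^ 2 ∣ x ^ 2 + 2))
    (hbox : 5 ^ S.card ≤
      Nat.card ((kubertTateFive (m : K) (n : K)).toAffine.Point ⧸ (nsmulAddMonoidHom (5 : ℕ) :
        (kubertTateFive (m : K) (n : K)).toAffine.Point →+ (kubertTateFive (m : K) (n : K)).toAffine.Point).range)) :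
    (shaMap ψ.toAddMonoidHom ψ.equivariant ψ.hasLocalPointsMaps_toAddMonoidHom).ker = ⊥ := by
  haveI := finite_ker_shaMap_dual_sqrtNegTwo m n ψ hψ
  have h := natCard_selmerGroup_dual_le_of_support_sqrtNegTwo m n ψ hψ P₁ hP₁ h25 hK S hS
  rw [natCard_selmerGroup_dual_eq_sqrtNegTwo m n ψ hψ hK h5 hbad] at h
  have hpos : 0 < Nat.card (shaMap ψ.toAddMonoidHom ψ.equivariant ψ.hasLocalPointsMaps_toAddMonoidHom).ker :=
    Nat.card_pos
  set N₀ := Nat.card (shaMap ψ.toAddMonoidHom ψ.equivariant ψ.hasLocalPointsMaps_toAddMonoidHom).ker with hN₀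
  set Q := Nat.card ((kubertTateFive (m : K) (n : K)).toAffine.Point ⧸ (nsmulAddMonoidHom (5 : ℕ) :
    (kubertTateFive (m : K) (n : K)).toAffine.Point →+ (kubertTateFive (m : K) (n : K)).toAffine.Point).range) with hQ
  have hQpos : 0 < Q := lt_of_lt_of_le (pow_pos (by norm_num) _) hbox
  have hK1 : N₀ ≤ 1 := by
    by_contra hK1
    have hK2 : 2 ≤ N₀ := Nat.succ_le_of_lt (lt_of_not_ge hK1)
    have h2 : Q * 2 ≤ Q := (Nat.mul_le_mul_left Q hK2).trans (h.trans hbox)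
    linarith
  have hone : N₀ = 1 := le_antisymm hK1 (Nat.succ_le_of_lt hpos)
  exact AddSubgroup.eq_bot_of_card_eq _ hone

include hP₁ h25 hK in
/-- **`Ш(E_{m,n}/K)[5] = 0` when the rational points fill the box** — the complete `5`-descent in the tame régime:
`Ш(E)[φ] = 0` (tree `KubertTateVelu.ker_shaMap_fiveIsogeny_eq_bot_sqrtNegTwo`) and `Ш(E')[ψ] = 0` bracket `Ш(E)[5]`
(tree `sha_torsionBy_eq_bot_of_ker_shaMap_eq_bot`). [cite: SilvermanAEC2009, Thm. X.4.2(a)] [cite: Fisher2001FiveSevenDescent, §2] -/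
theorem sha_torsionBy_five_eq_bot_of_le_sqrtNegTwo
    (S : Finset (HeightOneSpectrum (𝓞 K)))
    (hS : ∀ v : HeightOneSpectrum (𝓞 K), v ∉ S → ((m : ℤ) : 𝓞 K) ∉ v.asIdeal ∧ ((n : ℤ) : 𝓞 K) ∉ v.asIdeal)
    (h5 : ¬ (5 : ℤ) ∣ (kubertTateFive m n).Δ)
    (hbad : ∀ ℓ : ℕ, ℓ.Prime → (ℓ : ℤ) ∣ (kubertTateFive m n).Δ → ℓ % 5 ≠ 1 ∧
      (ℓ % 5 = 4 → ∃ x : ℤ, (ℓ : ℤ) ∣ x ^ 2 + 2 ∧ ¬ (ℓ : ℤ) ^ 2 ∣ x ^ 2 + 2))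
    (hbox : 5 ^ S.card ≤
      Nat.card ((kubertTateFive (m : K) (n : K)).toAffine.Point ⧸ (nsmulAddMonoidHom (5 : ℕ) :
        (kubertTateFive (m : K) (n : K)).toAffine.Point →+ (kubertTateFive (m : K) (n : K)).toAffine.Point).range)) : (kubertTateFive (m : K) (n : K)).sha[((5 : ℕ) : ℤ)] = ⊥ := by
  obtain ⟨ψ, hψ⟩ := exists_dual (K := K) m n
  exact sha_torsionBy_eq_bot_of_ker_shaMap_eq_bot (fiveIsogeny (m : K) (n : K)) ψ (n := 5) (by norm_num) hψ
    (ConstantKernelDescent.ker_shaMap_eq_bot_of_selmerGroup_eq_bot (fiveIsogeny (m : K) (n : K))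
      (KubertTateVelu.selmerGroup_fiveIsogeny_eq_bot_sqrtNegTwo m n hK h5 hbad))
    (ker_shaMap_dual_eq_bot_of_le_sqrtNegTwo m n ψ hψ P₁ hP₁ h25 hK S hS h5 hbad hbox)

include hP₁ h25 hK in
/-- `Ш(E_{m,n}/K)` has no element of order `5` (box full, tame). [cite: SilvermanAEC2009, Thm. X.4.2(a)] -/
theorem forall_mem_sha_five_nsmul_eq_zero_of_le_sqrtNegTwo
    (S : Finset (HeightOneSpectrum (𝓞 K)))
    (hS : ∀ v : HeightOneSpectrum (𝓞 K), v ∉ S → ((m : ℤ) : 𝓞 K) ∉ v.asIdeal ∧ ((n : ℤ) : 𝓞 K) ∉ v.asIdeal)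
    (h5 : ¬ (5 : ℤ) ∣ (kubertTateFive m n).Δ)
    (hbad : ∀ ℓ : ℕ, ℓ.Prime → (ℓ : ℤ) ∣ (kubertTateFive m n).Δ → ℓ % 5 ≠ 1 ∧
      (ℓ % 5 = 4 → ∃ x : ℤ, (ℓ : ℤ) ∣ x ^ 2 + 2 ∧ ¬ (ℓ : ℤ) ^ 2 ∣ x ^ 2 + 2))
    (hbox : 5 ^ S.card ≤
      Nat.card ((kubertTateFive (m : K) (n : K)).toAffine.Point ⧸ (nsmulAddMonoidHom (5 : ℕ) :
        (kubertTateFive (m : K) (n : K)).toAffine.Point →+ (kubertTateFive (m : K) (n : K)).toAffine.Point).range)) :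
    ∀ c ∈ (kubertTateFive (m : K) (n : K)).sha, (5 : ℕ) • c = 0 → c = 0 := by
  intro c hc h5c
  have hmem : (⟨c, hc⟩ : (kubertTateFive (m : K) (n : K)).sha) ∈ (kubertTateFive (m : K) (n : K)).sha[((5 : ℕ) : ℤ)] :=
    AddSubgroup.torsionBy.nsmul_iff.mpr (Subtype.ext h5c)
  rw [sha_torsionBy_five_eq_bot_of_le_sqrtNegTwo m n P₁ hP₁ h25 hK S hS h5 hbad hbox, AddSubgroup.mem_bot] at hmem
  exact congrArg Subtype.val hmem

include hP₁ h25 hK in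
/-- **`t₅(E_{m,n}) = corank_{ℤ₅} Ш(E_{m,n}/K)[5^∞] = 0` when the rational points fill the box (tame régime)** —
by descent alone, at any Mordell–Weil rank. [cite: SilvermanAEC2009, Thm. X.4.2(a)] [cite: Fisher2001FiveSevenDescent, §2] -/
theorem shaCorank_five_eq_zero_of_le_sqrtNegTwo
    (S : Finset (HeightOneSpectrum (𝓞 K)))
    (hS : ∀ v : HeightOneSpectrum (𝓞 K), v ∉ S → ((m : ℤ) : 𝓞 K) ∉ v.asIdeal ∧ ((n : ℤ) : 𝓞 K) ∉ v.asIdeal)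
    (h5 : ¬ (5 : ℤ) ∣ (kubertTateFive m n).Δ)
    (hbad : ∀ ℓ : ℕ, ℓ.Prime → (ℓ : ℤ) ∣ (kubertTateFive m n).Δ → ℓ % 5 ≠ 1 ∧
      (ℓ % 5 = 4 → ∃ x : ℤ, (ℓ : ℤ) ∣ x ^ 2 + 2 ∧ ¬ (ℓ : ℤ) ^ 2 ∣ x ^ 2 + 2))
    (hbox : 5 ^ S.card ≤
      Nat.card ((kubertTateFive (m : K) (n : K)).toAffine.Point ⧸ (nsmulAddMonoidHom (5 : ℕ) :
        (kubertTateFive (m : K) (n : K)).toAffine.Point →+ (kubertTateFive (m : K) (n : K)).toAffine.Point).range)) : (kubertTateFive (m : K) (n : K)).shaCorank 5 = 0 :=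
  (kubertTateFive (m : K) (n : K)).shaCorank_eq_zero_of_forall 5
    (forall_mem_sha_five_nsmul_eq_zero_of_le_sqrtNegTwo m n P₁ hP₁ h25 hK S hS h5 hbad hbox)

include hP₁ h25 hK in
/-- **`Ш(E_{m,n}/K)[5^∞] = 0`** when the rational points fill the box (tame régime). [cite: SilvermanAEC2009, Thm. X.4.2(a)] -/
theorem primaryComponent_sha_five_eq_bot_of_le_sqrtNegTwo
    (S : Finset (HeightOneSpectrum (𝓞 K)))
    (hS : ∀ v : HeightOneSpectrum (𝓞 K), v ∉ S → ((m : ℤ) : 𝓞 K) ∉ v.asIdeal ∧ ((n : ℤ) : 𝓞 K) ∉ v.asIdeal)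
    (h5 : ¬ (5 : ℤ) ∣ (kubertTateFive m n).Δ)
    (hbad : ∀ ℓ : ℕ, ℓ.Prime → (ℓ : ℤ) ∣ (kubertTateFive m n).Δ → ℓ % 5 ≠ 1 ∧
      (ℓ % 5 = 4 → ∃ x : ℤ, (ℓ : ℤ) ∣ x ^ 2 + 2 ∧ ¬ (ℓ : ℤ) ^ 2 ∣ x ^ 2 + 2))
    (hbox : 5 ^ S.card ≤
      Nat.card ((kubertTateFive (m : K) (n : K)).toAffine.Point ⧸ (nsmulAddMonoidHom (5 : ℕ) :
        (kubertTateFive (m : K) (n : K)).toAffine.Point →+ (kubertTateFive (m : K) (n : K)).toAffine.Point).range)) :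
    AddCommGroup.primaryComponent (kubertTateFive (m : K) (n : K)).sha 5 = ⊥ :=
  (kubertTateFive (m : K) (n : K)).primaryComponent_sha_eq_bot_of_forall
    (forall_mem_sha_five_nsmul_eq_zero_of_le_sqrtNegTwo m n P₁ hP₁ h25 hK S hS h5 hbad hbox)

include hP₁ h25 hK in
/-- … and the box is then EXACTLY full: `#(E(K)/5E(K)) = 5 ^ #S`. [cite: SilvermanAEC2009, Thm. X.4.2(a)] -/
theorem natCard_quotient_eq_of_le_sqrtNegTwo
    (S : Finset (HeightOneSpectrum (𝓞 K)))
    (hS : ∀ v : HeightOneSpectrum (𝓞 K), v ∉ S → ((m : ℤ) : 𝓞 K) ∉ v.asIdeal ∧ ((n : ℤ) : 𝓞 K) ∉ v.asIdeal)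
    (h5 : ¬ (5 : ℤ) ∣ (kubertTateFive m n).Δ)
    (hbad : ∀ ℓ : ℕ, ℓ.Prime → (ℓ : ℤ) ∣ (kubertTateFive m n).Δ → ℓ % 5 ≠ 1 ∧
      (ℓ % 5 = 4 → ∃ x : ℤ, (ℓ : ℤ) ∣ x ^ 2 + 2 ∧ ¬ (ℓ : ℤ) ^ 2 ∣ x ^ 2 + 2))
    (hbox : 5 ^ S.card ≤
      Nat.card ((kubertTateFive (m : K) (n : K)).toAffine.Point ⧸ (nsmulAddMonoidHom (5 : ℕ) :
        (kubertTateFive (m : K) (n : K)).toAffine.Point →+ (kubertTateFive (m : K) (n : K)).toAffine.Point).range)) :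
    Nat.card ((kubertTateFive (m : K) (n : K)).toAffine.Point ⧸ (nsmulAddMonoidHom (5 : ℕ) :
        (kubertTateFive (m : K) (n : K)).toAffine.Point →+ (kubertTateFive (m : K) (n : K)).toAffine.Point).range) =
      5 ^ S.card := by
  obtain ⟨ψ, hψ⟩ := exists_dual (K := K) m n
  exact le_antisymm (natCard_quotient_le_sqrtNegTwo m n ψ hψ P₁ hP₁ h25 hK S hS h5 hbad) hbox

end Tame

end KubertTateMuDescentNF

end Literature.NumberTheory.EllipticCurves

end
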